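import Mathlib
import HarnessLib
import Summits.CriticalPhenomena.PercolationContinuityZ3.Theorems.PercNearOneGluingNoHeavyLowerTailTwoCopyLadderAllGradesRail
import Summits.CriticalPhenomena.PercolationContinuityZ3.Theorems.PercNearOneGluingNoHeavyLowerTailTwoCopyLadderAllGradesApex

/-!
# The RAIL theorem on the extended orbit `𝒦⁺ × 𝒦⁺`, part 1: the apex pendant and the apex–`u` edge (sequel to `…AllGradesRail`, `…AllGradesApex`)

Helper file for crux `stmt-CriticalPhenomena-4575` (new-inequality factory `prim-ineq-gen-1`, gen 22); memo
`run/shared/lean/prim/prim-ineq-gen-1/FINDING-31-prism-programme-4terminal.md` §6.  `…AllGradesRail` proved that the all-grade rail form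
`Frail q X Y` (`= P_{G; av, zu}/q³` for `G ∖ av ∖ zu = X ∪_w Y`, the two sides sharing the terminal `w`, `f = zu` joining their `u`-terminals) lies in
every positive cone along the LADDER orbit `Orb` (moves: terminal rung, q-pendants at `u`, `w`, merge).  Here the three APEX moves of
`…AllGradesApex` are added — the q-pendant at the apex `qpendX` (an exact multiple, `Frail_qpendX`) and the apex–terminal edges `edgeXU`, `edgeXW`
(old form plus `ρ`, `ρ²` times nonnegative combinations of `Aq`, mirror-`Aq`, `Dl`, mirror-`Dl` of either side and a polynomial with nonnegative
coefficients: `Frail_edgeXU`, `Frail_edgeXW`; multipliers found by the bi-form tower kit j169926 — one generator, sixteen certificates, all integer —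
and checked here by `ring`) — so `Frail q X Y ∈ P` for ALL `X, Y` in the extended orbit `OrbX` (`Frail_pos_of_orbX`): for every `q ≥ 0` and in
every glueing `G = X ∪_w Y + zu + av` of two `𝒦⁺`-sides (strips with apex history: fans, wheels with a marked rim edge, triangulated bands, ladders
with diagonals) the apex edge `av` and the edge `zu` joining the two `u`-terminals are Rayleigh-negatively correlated at every `0 < q < 1`, with
nonnegative q-coefficients (`railX_allq_nonneg`, `railX_coeff_nonneg`, in part 2 `…AllGradesRailApex`).  This file: `Frail_qpendX`, `Frail_edgeXU` and the cone lemmas for its remainder chunks.  This is also 'Step A' of the 4-terminal (prism) programme: the `ρ⁰`-parts of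
the cyclic-ladder forms are rail forms at `𝒦⁺`-sides.  (This work, 2026-08-22.)
-/

namespace Summit.CriticalPhenomena.PercolationContinuityZ3.Theorems

namespace TwoCopyLadderAllGrades

open TwoCopyLadderCubic

variable {R : Type*} [CommRing R]

/-- The rail form under a q-pendant edge at the APEX of the first side scales exactly by `ρ(ρ+q)`. [this work] -/
theorem Frail_qpendX (q ρ : R) (X Y : SVec R) :
    Frail q (qpendX q ρ X) Y = (ρ ^ 2 + q * ρ) * Frail q X Y := by
  simp only [Frail, Aq, Bq, C0q, qpendX]; ring

/-- Part `a` of the `ρ` remainder of `Frail` under the apex–`u` edge on the first side (nonnegative combination of the side forms `Aq`, mirror-`Aq`, `Dl`, mirror-`Dl` and a polynomial with nonnegative integer coefficients; from the certificate kit j169926). [this work] -/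
def FedgeU1a (q : R) (X Y : SVec R) : R :=
  q ^ 2 * X.d * X.s * (Aq q Y)
    + q * X.d ^ 2 * (Aq q Y)
    + q ^ 2 * X.m * X.s * (Aq q Y)
    + 2 * q * X.m * X.d * (Aq q Y)
    + q * X.m ^ 2 * (Aq q Y)
    + 2 * q * X.p * X.d * (Aq q Y)
    + q * X.p * X.m * (Aq q Y)
    + 2 * X.c * X.d * (Aq q Y)
    + 2 * X.c * X.m * (Aq q Y)
    + q * X.c * X.p * (Aq q Y)
    + X.c ^ 2 * (Aq q Y)
    + q ^ 2 * Y.m * Y.d * (Dl X)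
    + q * Y.c * Y.d * (Dl X)
    + q * Y.c * Y.m * (Dl X)
    + Y.c ^ 2 * (Dl X)
    + q ^ 2 * X.d * X.s * (Dl Y)
    + q ^ 2 * X.m * X.s * (Dl Y)
    + 2 * q ^ 2 * X.p * X.s * (Dl Y)
    + q * X.p * X.d * (Dl Y)
    + q * X.p * X.m * (Dl Y)
    + q * X.c * X.s * (Dl Y)
    + q * X.c * X.p * (Dl Y)
    + q * (Dl (mir X)) * (Aq q Y)
    + Frail q X Y
    + 2 * X.p * X.s * Y.c ^ 2
    + 2 * X.p * X.d * Y.c * Y.p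
    + X.p * X.d * Y.c ^ 2
    + 2 * X.p * X.m * Y.c * Y.p
    + X.p * X.m * Y.c ^ 2
    + X.p ^ 2 * Y.c ^ 2
    + 2 * X.c * X.s * Y.c * Y.p
    + 2 * X.c * X.p * Y.c * Y.p
    + X.c * X.p * Y.c ^ 2
    + q * X.s ^ 2 * Y.c ^ 2
    + 2 * q * X.d * X.s * Y.c * Y.p
    + q * X.d * X.s * Y.c ^ 2

/-- Part `b` of the `ρ` remainder of `Frail` under the apex–`u` edge on the first side (nonnegative combination of the side forms `Aq`, mirror-`Aq`, `Dl`, mirror-`Dl` and a polynomial with nonnegative integer coefficients; from the certificate kit j169926). [this work] -/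
def FedgeU1b (q : R) (X Y : SVec R) : R :=
  2 * q * X.m * X.s * Y.c * Y.p
    + q * X.m * X.s * Y.c ^ 2
    + q * X.m * X.d * Y.c ^ 2
    + 2 * q * X.p * X.s * Y.c * Y.d
    + 2 * q * X.p * X.s * Y.c * Y.m
    + 4 * q * X.p * X.s * Y.c * Y.p
    + q * X.p * X.d * Y.p * Y.d
    + q * X.p * X.d * Y.p * Y.m
    + q * X.p * X.d * Y.p ^ 2
    + q * X.p * X.d * Y.c * Y.d
    + q * X.p * X.d * Y.c * Y.m
    + q * X.p * X.m * Y.p * Y.d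
    + q * X.p * X.m * Y.p * Y.m
    + q * X.p * X.m * Y.p ^ 2
    + q * X.p * X.m * Y.c * Y.d
    + q * X.p * X.m * Y.c * Y.m
    + q * X.p ^ 2 * Y.c * Y.d
    + q * X.p ^ 2 * Y.c * Y.m
    + 2 * q * X.p ^ 2 * Y.c * Y.p
    + q * X.c * X.s * Y.p * Y.d
    + q * X.c * X.s * Y.p * Y.m
    + q * X.c * X.s * Y.p ^ 2
    + q * X.c * X.p * Y.p * Y.d
    + q * X.c * X.p * Y.p * Y.m
    + q * X.c * X.p * Y.p ^ 2
    + q * X.c * X.p * Y.c * Y.d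
    + q * X.c * X.p * Y.c * Y.m
    + q ^ 2 * X.s ^ 2 * Y.c * Y.d
    + q ^ 2 * X.s ^ 2 * Y.c * Y.m
    + 2 * q ^ 2 * X.s ^ 2 * Y.c * Y.p
    + q ^ 2 * X.d * X.s * Y.p * Y.d
    + q ^ 2 * X.d * X.s * Y.p * Y.m
    + q ^ 2 * X.d * X.s * Y.p ^ 2
    + q ^ 2 * X.d * X.s * Y.c * Y.d
    + q ^ 2 * X.d * X.s * Y.c * Y.m
    + q ^ 2 * X.m * X.s * Y.p * Y.d

/-- Part `c` of the `ρ` remainder of `Frail` under the apex–`u` edge on the first side (nonnegative combination of the side forms `Aq`, mirror-`Aq`, `Dl`, mirror-`Dl` and a polynomial with nonnegative integer coefficients; from the certificate kit j169926). [this work] -/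
def FedgeU1c (q : R) (X Y : SVec R) : R :=
  q ^ 2 * X.m * X.s * Y.p * Y.m
    + q ^ 2 * X.m * X.s * Y.p ^ 2
    + q ^ 2 * X.m * X.s * Y.c * Y.d
    + q ^ 2 * X.m * X.s * Y.c * Y.m
    + q ^ 2 * X.m * X.d * Y.c * Y.d
    + q ^ 2 * X.m * X.d * Y.c * Y.m
    + 2 * q ^ 2 * X.p * X.s * Y.m * Y.d
    + 2 * q ^ 2 * X.p * X.s * Y.p * Y.d
    + 2 * q ^ 2 * X.p * X.s * Y.p * Y.m
    + 2 * q ^ 2 * X.p * X.s * Y.p ^ 2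
    + q ^ 2 * X.p * X.d * Y.m * Y.d
    + q ^ 2 * X.p * X.d * Y.p * Y.s
    + q ^ 2 * X.p * X.m * Y.m * Y.d
    + q ^ 2 * X.p * X.m * Y.p * Y.s
    + q ^ 2 * X.p ^ 2 * Y.p * Y.d
    + q ^ 2 * X.p ^ 2 * Y.p * Y.m
    + q ^ 2 * X.p ^ 2 * Y.p ^ 2
    + q ^ 2 * X.p ^ 2 * Y.c * Y.s
    + q ^ 2 * X.c * X.s * Y.p * Y.s
    + q ^ 2 * X.c * X.p * Y.m * Y.d
    + q ^ 2 * X.c * X.p * Y.p * Y.s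
    + q ^ 3 * X.s ^ 2 * Y.p * Y.d
    + q ^ 3 * X.s ^ 2 * Y.p * Y.m
    + q ^ 3 * X.s ^ 2 * Y.p ^ 2
    + q ^ 3 * X.s ^ 2 * Y.c * Y.s
    + q ^ 3 * X.d * X.s * Y.m * Y.d
    + q ^ 3 * X.d * X.s * Y.p * Y.s
    + q ^ 3 * X.m * X.s * Y.m * Y.d
    + q ^ 3 * X.m * X.s * Y.p * Y.s
    + q ^ 3 * X.m * X.d * Y.m * Y.d
    + 2 * q ^ 3 * X.p * X.s * Y.p * Y.s
    + q ^ 3 * X.p ^ 2 * Y.p * Y.s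
    + q ^ 4 * X.s ^ 2 * Y.p * Y.s

/-- Part `a` of the `ρ²` remainder of `Frail` under the apex–`u` edge on the first side (nonnegative combination of the side forms `Aq`, mirror-`Aq`, `Dl`, mirror-`Dl` and a polynomial with nonnegative integer coefficients; from the certificate kit j169926). [this work] -/
def FedgeU2a (q : R) (X Y : SVec R) : R :=
  q * X.d * X.s * (Aq q Y)
    + X.d ^ 2 * (Aq q Y)
    + q * X.m * X.s * (Aq q Y)
    + 2 * X.m * X.d * (Aq q Y)
    + X.m ^ 2 * (Aq q Y)
    + 2 * q * X.p * X.d * (Aq q Y)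
    + q * X.p * X.m * (Aq q Y)
    + 2 * X.c * X.d * (Aq q Y)
    + 2 * X.c * X.m * (Aq q Y)
    + q * X.c * X.p * (Aq q Y)
    + X.c ^ 2 * (Aq q Y)
    + q * X.d * X.s * (Dl Y)
    + q * X.m * X.s * (Dl Y)
    + q * X.p * X.d * (Dl Y)
    + q * X.p * X.m * (Dl Y)
    + q * X.c * X.s * (Dl Y)
    + q * X.c * X.p * (Dl Y)
    + q * (Dl (mir X)) * (Aq q Y)
    + X.s ^ 2 * Y.c ^ 2
    + 2 * X.d * X.s * Y.c * Y.p
    + X.d * X.s * Y.c ^ 2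
    + 2 * X.m * X.s * Y.c * Y.p
    + X.m * X.s * Y.c ^ 2
    + 2 * X.p * X.s * Y.c ^ 2
    + 2 * X.p * X.d * Y.c * Y.p
    + X.p * X.d * Y.c ^ 2
    + 2 * X.p * X.m * Y.c * Y.p
    + X.p * X.m * Y.c ^ 2
    + X.p ^ 2 * Y.c ^ 2
    + 2 * X.c * X.s * Y.c * Y.p
    + X.c * X.s * Y.c ^ 2
    + 2 * X.c * X.p * Y.c * Y.p
    + X.c * X.p * Y.c ^ 2
    + q * X.s ^ 2 * Y.c * Y.d
    + q * X.s ^ 2 * Y.c * Y.m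
    + 2 * q * X.s ^ 2 * Y.c * Y.p

/-- Part `b` of the `ρ²` remainder of `Frail` under the apex–`u` edge on the first side (nonnegative combination of the side forms `Aq`, mirror-`Aq`, `Dl`, mirror-`Dl` and a polynomial with nonnegative integer coefficients; from the certificate kit j169926). [this work] -/
def FedgeU2b (q : R) (X Y : SVec R) : R :=
  q * X.d * X.s * Y.p * Y.d
    + q * X.d * X.s * Y.p * Y.m
    + q * X.d * X.s * Y.p ^ 2
    + q * X.d * X.s * Y.c * Y.d
    + q * X.d * X.s * Y.c * Y.m
    + q * X.m * X.s * Y.p * Y.d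
    + q * X.m * X.s * Y.p * Y.m
    + q * X.m * X.s * Y.p ^ 2
    + q * X.m * X.s * Y.c * Y.d
    + q * X.m * X.s * Y.c * Y.m
    + 2 * q * X.p * X.s * Y.c * Y.d
    + 2 * q * X.p * X.s * Y.c * Y.m
    + 4 * q * X.p * X.s * Y.c * Y.p
    + q * X.p * X.d * Y.p * Y.d
    + q * X.p * X.d * Y.p * Y.m
    + q * X.p * X.d * Y.p ^ 2
    + q * X.p * X.d * Y.c * Y.d
    + q * X.p * X.d * Y.c * Y.m
    + q * X.p * X.m * Y.p * Y.d
    + q * X.p * X.m * Y.p * Y.m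
    + q * X.p * X.m * Y.p ^ 2
    + q * X.p * X.m * Y.c * Y.d
    + q * X.p * X.m * Y.c * Y.m
    + q * X.p ^ 2 * Y.c * Y.d
    + q * X.p ^ 2 * Y.c * Y.m
    + 2 * q * X.p ^ 2 * Y.c * Y.p
    + q * X.c * X.s * Y.p * Y.d
    + q * X.c * X.s * Y.p * Y.m
    + q * X.c * X.s * Y.p ^ 2
    + q * X.c * X.s * Y.c * Y.d
    + q * X.c * X.s * Y.c * Y.m
    + q * X.c * X.p * Y.p * Y.d
    + q * X.c * X.p * Y.p * Y.m
    + q * X.c * X.p * Y.p ^ 2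
    + q * X.c * X.p * Y.c * Y.d
    + q * X.c * X.p * Y.c * Y.m

/-- Part `c` of the `ρ²` remainder of `Frail` under the apex–`u` edge on the first side (nonnegative combination of the side forms `Aq`, mirror-`Aq`, `Dl`, mirror-`Dl` and a polynomial with nonnegative integer coefficients; from the certificate kit j169926). [this work] -/
def FedgeU2c (q : R) (X Y : SVec R) : R :=
  q ^ 2 * X.s ^ 2 * Y.p * Y.d
    + q ^ 2 * X.s ^ 2 * Y.p * Y.m
    + q ^ 2 * X.s ^ 2 * Y.p ^ 2
    + q ^ 2 * X.s ^ 2 * Y.c * Y.s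
    + q ^ 2 * X.d * X.s * Y.m * Y.d
    + q ^ 2 * X.d * X.s * Y.p * Y.s
    + q ^ 2 * X.m * X.s * Y.m * Y.d
    + q ^ 2 * X.m * X.s * Y.p * Y.s
    + 2 * q ^ 2 * X.p * X.s * Y.p * Y.d
    + 2 * q ^ 2 * X.p * X.s * Y.p * Y.m
    + 2 * q ^ 2 * X.p * X.s * Y.p ^ 2
    + 2 * q ^ 2 * X.p * X.s * Y.c * Y.s
    + q ^ 2 * X.p * X.d * Y.m * Y.d
    + q ^ 2 * X.p * X.d * Y.p * Y.s
    + q ^ 2 * X.p * X.m * Y.m * Y.d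
    + q ^ 2 * X.p * X.m * Y.p * Y.s
    + q ^ 2 * X.p ^ 2 * Y.p * Y.d
    + q ^ 2 * X.p ^ 2 * Y.p * Y.m
    + q ^ 2 * X.p ^ 2 * Y.p ^ 2
    + q ^ 2 * X.p ^ 2 * Y.c * Y.s
    + q ^ 2 * X.c * X.s * Y.m * Y.d
    + q ^ 2 * X.c * X.s * Y.p * Y.s
    + q ^ 2 * X.c * X.p * Y.m * Y.d
    + q ^ 2 * X.c * X.p * Y.p * Y.s
    + q ^ 3 * X.s ^ 2 * Y.p * Y.s
    + 2 * q ^ 3 * X.p * X.s * Y.p * Y.s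
    + q ^ 3 * X.p ^ 2 * Y.p * Y.s

/-- The rail form under the apex–`u` edge of weight `ρ` on the first side: old form plus `ρ`, `ρ²` times the nonnegative remainders above. [this work] -/
theorem Frail_edgeXU (q ρ : R) (X Y : SVec R) :
    Frail q (edgeXU ρ X) Y = Frail q X Y + ρ * (FedgeU1a q X Y + FedgeU1b q X Y + FedgeU1c q X Y) + ρ ^ 2 * (FedgeU2a q X Y + FedgeU2b q X Y + FedgeU2c q X Y) := by
  simp only [Frail, Aq, Bq, C0q, Dl, mir, edgeXU, FedgeU1a, FedgeU1b, FedgeU1c, FedgeU2a, FedgeU2b, FedgeU2c]; ring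

/-- `FedgeU1a` lies in the cone when the entries and side forms of both sides and the old rail form do. [this work] -/
theorem FedgeU1a_pos {P : R → Prop} (hP : IsPosCone P) {q : R} (hq : P q) {X Y : SVec R} (hX : GoodX P q X) (hY : GoodX P q Y)
    (hF : P (Frail q X Y)) :
    P (FedgeU1a q X Y) := by
  obtain ⟨hc, hp, hm, hd, hs, hA, hAm, hD, hDm⟩ := hX
  obtain ⟨hC, hPp, hM, hDd, hS, hAY, hAmY, hDY, hDmY⟩ := hY
  unfold FedgeU1a
  apply_rules (maxDepth := 5000) [hP.add, hP.mul, hP.pow, hP.zero, hP.one, hP.ofNat]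

/-- `FedgeU1b` lies in the cone when the entries and side forms of both sides do. [this work] -/
theorem FedgeU1b_pos {P : R → Prop} (hP : IsPosCone P) {q : R} (hq : P q) {X Y : SVec R} (hX : GoodX P q X) (hY : GoodX P q Y) :
    P (FedgeU1b q X Y) := by
  obtain ⟨hc, hp, hm, hd, hs, hA, hAm, hD, hDm⟩ := hX
  obtain ⟨hC, hPp, hM, hDd, hS, hAY, hAmY, hDY, hDmY⟩ := hY
  unfold FedgeU1b
  apply_rules (maxDepth := 5000) [hP.add, hP.mul, hP.pow, hP.zero, hP.one, hP.ofNat]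

/-- `FedgeU1c` lies in the cone when the entries and side forms of both sides do. [this work] -/
theorem FedgeU1c_pos {P : R → Prop} (hP : IsPosCone P) {q : R} (hq : P q) {X Y : SVec R} (hX : GoodX P q X) (hY : GoodX P q Y) :
    P (FedgeU1c q X Y) := by
  obtain ⟨hc, hp, hm, hd, hs, hA, hAm, hD, hDm⟩ := hX
  obtain ⟨hC, hPp, hM, hDd, hS, hAY, hAmY, hDY, hDmY⟩ := hY
  unfold FedgeU1c
  apply_rules (maxDepth := 5000) [hP.add, hP.mul, hP.pow, hP.zero, hP.one, hP.ofNat]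

/-- `FedgeU2a` lies in the cone when the entries and side forms of both sides do. [this work] -/
theorem FedgeU2a_pos {P : R → Prop} (hP : IsPosCone P) {q : R} (hq : P q) {X Y : SVec R} (hX : GoodX P q X) (hY : GoodX P q Y) :
    P (FedgeU2a q X Y) := by
  obtain ⟨hc, hp, hm, hd, hs, hA, hAm, hD, hDm⟩ := hX
  obtain ⟨hC, hPp, hM, hDd, hS, hAY, hAmY, hDY, hDmY⟩ := hY
  unfold FedgeU2a
  apply_rules (maxDepth := 5000) [hP.add, hP.mul, hP.pow, hP.zero, hP.one, hP.ofNat]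

/-- `FedgeU2b` lies in the cone when the entries and side forms of both sides do. [this work] -/
theorem FedgeU2b_pos {P : R → Prop} (hP : IsPosCone P) {q : R} (hq : P q) {X Y : SVec R} (hX : GoodX P q X) (hY : GoodX P q Y) :
    P (FedgeU2b q X Y) := by
  obtain ⟨hc, hp, hm, hd, hs, hA, hAm, hD, hDm⟩ := hX
  obtain ⟨hC, hPp, hM, hDd, hS, hAY, hAmY, hDY, hDmY⟩ := hY
  unfold FedgeU2b
  apply_rules (maxDepth := 5000) [hP.add, hP.mul, hP.pow, hP.zero, hP.one, hP.ofNat]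

/-- `FedgeU2c` lies in the cone when the entries and side forms of both sides do. [this work] -/
theorem FedgeU2c_pos {P : R → Prop} (hP : IsPosCone P) {q : R} (hq : P q) {X Y : SVec R} (hX : GoodX P q X) (hY : GoodX P q Y) :
    P (FedgeU2c q X Y) := by
  obtain ⟨hc, hp, hm, hd, hs, hA, hAm, hD, hDm⟩ := hX
  obtain ⟨hC, hPp, hM, hDd, hS, hAY, hAmY, hDY, hDmY⟩ := hY
  unfold FedgeU2c
  apply_rules (maxDepth := 5000) [hP.add, hP.mul, hP.pow, hP.zero, hP.one, hP.ofNat]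

end TwoCopyLadderAllGrades

end Summit.CriticalPhenomena.PercolationContinuityZ3.Theorems
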